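import Literature.AnabelianGeometry.SemiGraphs.ArithmeticCoverings
import Literature.Algebra.Homology.SplitExtensionSplittings
import Literature.Algebra.Homology.ExtensionInducedAction

/-!
# Sub-DAG of [SemiAnbd] Lemma 5.5, row L03/L05 made literal: the Kummer class `η_a ∈ H¹(k, T)` of a section, on Mathlib's `groupCohomology.H1`

Mochizuki, *Semi-graphs of anabelioids*, Publ. RIMS **42** (2006); kurims manuscript
`paper:url-f33ace170ff4`, proof of Lemma 5.5, p.67 l.3–11: "Write `σ_0 : G_k → Π_J` for the outer
homomorphism induced by the identity element of `J(k)`. Then the difference between `σ_a` and `σ_0` may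
be thought of as an element of `η_a ∈ H¹(k, T)`, where we define `T` to be the kernel of the natural
surjection `Π_J ↠ G_k`. … there is a natural isomorphism `H¹(k, T) ⥲ J(k)`, which maps `η_a` to `a`.  In
particular, `η_a`, hence also `σ_a`, is sufficient to determine `a` itself."
[cite: MochizukiSemiAnbd2006, Lem 5.5 proof, p. 67]  Companion of `ArithmeticCoveringsLem55Sub.lean`
(same seat; cell file `plan/L3/SUBDAG-SemiAnbd-Lem55.md`, rows L03/L05/L06), human ruling D-0068 (1).

There the class `η` was read as the `T`-conjugacy class of the section (`Lem55.IsKerConj`).  Here the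
extension `1 → T → Π_J → G_k → 1` with COMMUTATIVE `T` enters as a Mathlib `GroupExtension
(Multiplicative V) Π_J G_k` (`V` = `T` written additively), and `η` is typed LITERALLY as an element of
`groupCohomology.H1` of the induced `G_k`-module (`Literature.Algebra.Homology.ExtensionClass.inducedRep`,
Brown IV (1.1)) via the tree's Brown IV Prop. 2.3 `ExtensionClass.conjClassesEquivH1`
(`T`-conjugacy classes of splittings `≃ H¹`), relative to the base section `σ_0`:

* `splittingOfSection`, `kummerClass S σ₀ s` (= `η(s) := [d_{s,σ₀}] ∈ H¹(G_k, T)`, row L03);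
* `isConj_iff_exists_ker_conj` (Mathlib's `S.IsConj` = the Sub file's `IsKerConj S.rightHom`, read without
  importing it), `isConj_of_conj` (sections conjugate under ANY `g ∈ Π_J` are `T`-conjugate: the image of
  `g` in `G_k` centralises `G_k`), `kummerClass_eq_of_conj` (`η` is an invariant of the OUTER section) — PROVED;
* `KummerIsoH1Statement` (row L05, the cited fact [Naka]/[NTs]/[Mzk2] LITERALLY: `a ↦ η_a` is a bijection
  `J(k) → H¹(k, T)`; NOT asserted), `KummerInjectiveH1Statement` (its load-bearing half);
* `decompositionGroupsDetermine_of_kummerClass_injective` (row L06 for `J`: the cone's named-fact SHAPE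
  `DecompositionGroupsDetermineStatement S.rightHom σJ` (F-1367's statement at the Jacobian data) FOLLOWS
  from the injectivity of `a ↦ η_a`) — PROVED.

Universe note: the tree's `inducedRep`/`conjClassesEquivH1` take `G_k`, `T` in `Type` (coefficients `ℤ`);
`Π_J` is universe-polymorphic.  No instance, no notation, no `sorry`; the fact stays a hypothesis
(FACT-policy D); nothing downstream ([IUTchIII] Cor 3.12) is touched.
-/

noncomputable section

namespace Literature.AnabelianGeometry.SemiGraphs

namespace Lem55

open Literature.Algebra.Homology Literature.Algebra.Homology.ExtensionClass groupCohomology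

universe v

variable {Gk : Type} [Group Gk] {V : Type} [AddCommGroup V] {PJ : Type v} [Group PJ]
  (S : GroupExtension (Multiplicative V) PJ Gk)

/-! ### Sections as splittings -/

/-- A section `s : G_k → Π_J` of `Π_J ↠ G_k` (a homomorphism with `π ∘ s = id`) as a Mathlib splitting of
the extension. [cite: MochizukiSemiAnbd2006, Lem 5.5 proof, p. 67] -/
def splittingOfSection (s : Gk →* PJ) (hs : S.rightHom.comp s = MonoidHom.id Gk) : S.Splitting :=
  ⟨s, fun g => by simpa using DFunLike.congr_fun hs g⟩

/-- Unfolding. [cite: MochizukiSemiAnbd2006, Lem 5.5 proof, p. 67] -/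
@[simp]
theorem splittingOfSection_apply (s : Gk →* PJ) (hs : S.rightHom.comp s = MonoidHom.id Gk) (t : Gk) :
    splittingOfSection S s hs t = s t := rfl

/-! ### L03 — `η(s) ∈ H¹(G_k, T)` -/

/-- **Row L03, literal.** The Kummer / difference class of a section `s` relative to the base section
`σ₀`: `η(s) := [t ↦ s(t) σ₀(t)⁻¹] ∈ H¹(G_k, T)` ("the difference between `σ_a` and `σ_0` may be thought of
as an element `η_a ∈ H¹(k, T)`"), through Brown IV Prop. 2.3 (`conjClassesEquivH1`) for the induced
`G_k`-module `T`. [cite: MochizukiSemiAnbd2006, Lem 5.5 proof, p. 67] -/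
def kummerClass (σ₀ : S.Splitting) (s : Gk →* PJ) (hs : S.rightHom.comp s = MonoidHom.id Gk) :
    H1 (inducedRep S) :=
  conjClassesEquivH1 (inducesAction_inducedRep S) σ₀
    (Quotient.mk (GroupExtension.IsConj.setoid S) (splittingOfSection S s hs))

/-- Mathlib's `T`-conjugacy of splittings (`S.IsConj`) is conjugacy by an element of `Ker(Π_J ↠ G_k)` —
the relation `Lem55.IsKerConj S.rightHom` of the companion file, read here without importing it.
[cite: MochizukiSemiAnbd2006, Lem 5.5 proof, p. 67] -/
theorem isConj_iff_exists_ker_conj (s s' : S.Splitting) :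
    S.IsConj s s' ↔ ∃ τ ∈ S.rightHom.ker, ∀ t : Gk, s t = τ * s' t * τ⁻¹ := by
  constructor
  · rintro ⟨n, hn⟩
    refine ⟨S.inl n, ?_, fun t => ?_⟩
    · rw [← S.range_inl_eq_ker_rightHom]; exact ⟨n, rfl⟩
    · exact congrFun hn t
  · rintro ⟨τ, hτ, h⟩
    rw [← S.range_inl_eq_ker_rightHom] at hτ
    obtain ⟨n, rfl⟩ := hτ
    exact ⟨n, funext h⟩

/-- Sections conjugate under an ARBITRARY `g ∈ Π_J` (the equivalence of OUTER homomorphisms in the lemma)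
are `T`-conjugate: the image of `g` in `G_k` centralises `G_k`, so `τ := g · s(π g)⁻¹ ∈ T` conjugates
`s` to `s'`. PROVED (group theory). [cite: MochizukiSemiAnbd2006, Lem 5.5 proof, p. 67] -/
theorem isConj_of_conj (s s' : Gk →* PJ) (hs : S.rightHom.comp s = MonoidHom.id Gk)
    (hs' : S.rightHom.comp s' = MonoidHom.id Gk) (g : PJ) (hg : ∀ t : Gk, s' t = g * s t * g⁻¹) :
    S.IsConj (splittingOfSection S s' hs') (splittingOfSection S s hs) := by
  rw [isConj_iff_exists_ker_conj]
  have h1 : ∀ t, S.rightHom (s t) = t := fun t => by simpa using DFunLike.congr_fun hs t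
  have h2 : ∀ t, S.rightHom (s' t) = t := fun t => by simpa using DFunLike.congr_fun hs' t
  have hcomm : ∀ t : Gk, S.rightHom g * t = t * S.rightHom g := fun t => by
    have := h2 t
    rw [hg t, map_mul, map_mul, map_inv, h1 t] at this
    calc S.rightHom g * t = S.rightHom g * t * (S.rightHom g)⁻¹ * S.rightHom g := by group
      _ = t * S.rightHom g := by rw [this]
  refine ⟨g * (s (S.rightHom g))⁻¹, ?_, fun t => ?_⟩
  · rw [MonoidHom.mem_ker, map_mul, map_inv, h1, mul_inv_cancel]
  · have key : s (S.rightHom g) * s t * (s (S.rightHom g))⁻¹ = s t := by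
      rw [← map_mul, ← map_inv, ← map_mul, hcomm t, mul_inv_cancel_right]
    rw [splittingOfSection_apply, splittingOfSection_apply]
    calc s' t = g * s t * g⁻¹ := hg t
      _ = g * (s (S.rightHom g))⁻¹ * (s (S.rightHom g) * s t * (s (S.rightHom g))⁻¹) *
            (g * (s (S.rightHom g))⁻¹)⁻¹ := by group
      _ = g * (s (S.rightHom g))⁻¹ * s t * (g * (s (S.rightHom g))⁻¹)⁻¹ := by rw [key]

/-- `η` is an invariant of the OUTER section: `Π_J`-conjugate sections have the same class in
`H¹(G_k, T)`. PROVED. [cite: MochizukiSemiAnbd2006, Lem 5.5 proof, p. 67] -/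
theorem kummerClass_eq_of_conj (σ₀ : S.Splitting) (s s' : Gk →* PJ)
    (hs : S.rightHom.comp s = MonoidHom.id Gk) (hs' : S.rightHom.comp s' = MonoidHom.id Gk) (g : PJ)
    (hg : ∀ t : Gk, s' t = g * s t * g⁻¹) :
    kummerClass S σ₀ s' hs' = kummerClass S σ₀ s hs :=
  congrArg (conjClassesEquivH1 (inducesAction_inducedRep S) σ₀)
    (Quotient.sound (isConj_of_conj S s s' hs hs' g hg))

/-- Conversely, sections with the same class are `T`-conjugate (Brown IV Prop. 2.3 is a bijection), in
particular conjugate in `Π_J`. PROVED. [cite: MochizukiSemiAnbd2006, Lem 5.5 proof, p. 67] -/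
theorem exists_conj_of_kummerClass_eq (σ₀ : S.Splitting) (s s' : Gk →* PJ)
    (hs : S.rightHom.comp s = MonoidHom.id Gk) (hs' : S.rightHom.comp s' = MonoidHom.id Gk)
    (h : kummerClass S σ₀ s' hs' = kummerClass S σ₀ s hs) :
    ∃ g : PJ, ∀ t : Gk, s' t = g * s t * g⁻¹ := by
  have hq := (conjClassesEquivH1 (inducesAction_inducedRep S) σ₀).injective h
  have hc : S.IsConj (splittingOfSection S s' hs') (splittingOfSection S s hs) := Quotient.exact hq
  obtain ⟨τ, -, hτ⟩ := (isConj_iff_exists_ker_conj S _ _).1 hc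
  exact ⟨τ, fun t => by simpa using hτ t⟩

/-! ### L05 — the cited isomorphism `H¹(k, T) ⥲ J(k)`, `η_a ↦ a`, literal -/

variable {JPts : Type*} (σJ : JPts → (Gk →* PJ)) (hσJ : ∀ a : JPts, S.rightHom.comp (σJ a) = MonoidHom.id Gk)

/-- **Row L05, literal.** "there is a natural isomorphism `H¹(k, T) ⥲ J(k)`, which maps `η_a` to `a`"
([Naka] Claim (2.2); [NTs] Lemma (4.14); [Mzk2], Remark before Def. 6.2): on abstract data (`J(k)` a type
`JPts` with its sections `σJ`, base section `σ₀ = σJ 0`), the map `a ↦ η_a ∈ H¹(G_k, T)` is a BIJECTION.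
FACT-policy: NOT asserted. [cite: MochizukiSemiAnbd2006, Lem 5.5 proof, p. 67] -/
def KummerIsoH1Statement (σ₀ : S.Splitting) : Prop :=
  Function.Bijective fun a : JPts => kummerClass S σ₀ (σJ a) (hσJ a)

/-- The load-bearing half of L05: `a ↦ η_a` is injective. FACT-policy: NOT asserted.
[cite: MochizukiSemiAnbd2006, Lem 5.5 proof, p. 67] -/
def KummerInjectiveH1Statement (σ₀ : S.Splitting) : Prop :=
  Function.Injective fun a : JPts => kummerClass S σ₀ (σJ a) (hσJ a)

/-- L05 ⇒ its injectivity half. [cite: MochizukiSemiAnbd2006, Lem 5.5 proof, p. 67] -/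
theorem kummerInjectiveH1_of_iso (σ₀ : S.Splitting) (h : KummerIsoH1Statement S σJ hσJ σ₀) :
    KummerInjectiveH1Statement S σJ hσJ σ₀ :=
  h.1

/-! ### L06 — "`η_a`, hence also `σ_a`, is sufficient to determine `a` itself" -/

/-- **Row L06 (for the Jacobian data), PROVED.** The cone's named-fact shape
`DecompositionGroupsDetermineStatement` at `(Π_J ↠ G_k, J(k))` follows from the injectivity of the Kummer
map `a ↦ η_a ∈ H¹(G_k, T)` (row L05), via `kummerClass_eq_of_conj` (row L03).  The input is a hypothesis;
nothing is discharged. [cite: MochizukiSemiAnbd2006, Lem 5.5 proof, p. 67] -/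
theorem decompositionGroupsDetermine_of_kummerClass_injective (σ₀ : S.Splitting)
    (h : KummerInjectiveH1Statement S σJ hσJ σ₀) :
    DecompositionGroupsDetermineStatement S.rightHom σJ := by
  intro _ a b hab
  obtain ⟨g, hg⟩ := hab
  have hcl : kummerClass S σ₀ (σJ b) (hσJ b) = kummerClass S σ₀ (σJ a) (hσJ a) :=
    kummerClass_eq_of_conj S σ₀ (σJ a) (σJ b) (hσJ a) (hσJ b) g hg
  exact (h hcl).symm

/-- … and conversely the named-fact shape at the Jacobian data GIVES the injectivity of `a ↦ η_a` (so,
at `J`, F-1367's statement and L05-injectivity are EQUIVALENT readings). PROVED.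
[cite: MochizukiSemiAnbd2006, Lem 5.5 proof, p. 67] -/
theorem kummerClass_injective_of_decompositionGroupsDetermine (σ₀ : S.Splitting)
    (h : DecompositionGroupsDetermineStatement S.rightHom σJ) :
    KummerInjectiveH1Statement S σJ hσJ σ₀ := by
  intro a b hab
  obtain ⟨g, hg⟩ := exists_conj_of_kummerClass_eq S σ₀ (σJ a) (σJ b) (hσJ a) (hσJ b) hab.symm
  exact h hσJ a b ⟨g, hg⟩

end Lem55

end Literature.AnabelianGeometry.SemiGraphs

end
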